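import Summits.Ventures.DiscreteObjects.Hadamard.PrimeOrderSmallParity

/-!
# Hadamard 668 census, family F12 — the forced orbit numbers for p = 3, 5, 7 fully in the kernel (discrete second moment)

Framing: lottery ticket; floor = certified bounds/negative ranges.

Cell pub-namedobj (venture DiscreteObjects), target (H), hadamard gen 8.  `PrimeOrderSmallParity` left the windows
`p = 3: 150 ≤ m ≤ 222`, `p = 5: 108 ≤ m ≤ 132`, `p = 7: 82 ≤ m ≤ 94` (Cauchy–Schwarz + parity); the census (FAMILY-F12-G5 §7) cut
them further to `168 ≤ m`, `112 ≤ m`, `84 ≤ m` by an exact orbit-row enumeration (two implementations).  This file puts those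
cuts in the kernel WITHOUT enumeration: the orbit row `(w_j)` of a moved point consists of INTEGERS with `Σ w_j = 333 - σ` and
`Σ w_j² = 167 + 166 p - p σ` (`0 ≤ σ ≤ 333` the number of fixed blocks through the point), and for integers
`Σ_j (w_j - t)(w_j - t - 1) ≥ 0` for every integer `t`, i.e. `Σ w_j² ≥ (2t+1) Σ w_j - m t (t+1)` (`sum_sq_ge_discrete`; the real
Cauchy–Schwarz bound is the case `t = Σw/m`).  With `t = ⌊(333 - σ)/m⌋` this is violated for every `σ ∈ [0, 333]` when
`(p, m) ∈ {3} × [150, 166] ∪ {5} × [107, 111] ∪ {7} × {82, 83}` (`disc3`, `disc5`, `disc7`, `decide`).  Results: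
**`orbitCount_3'`: `168 ≤ m ≤ 222`, `m` even; `orbitCount_5'`: `112 ≤ m ≤ 132`, `m` even; `orbitCount_7'`: `84 ≤ m ≤ 94`, `m` even** —
exactly the census statements for these primes (the census line (4) 'forced orbit numbers' are now kernel for every surviving
prime: 3, 5, 7 here; 11 `orbitCount_11`; 13 `orbitStructure_13`; 23 `fixedSubstructure_23`; 37, 41, 83 `fixedSubstructure_*`).
`orbitCount_moments` re-derives the two orbit-row identities of `orbitCount_cs` (same construction, verbatim) but exports the
discrete family of inequalities instead of Cauchy–Schwarz.  Ours, not literature; no `sorry`; `decide` only for the three tables.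
-/

open Finset BigOperators

namespace Summit.Ventures.DiscreteObjects.Hadamard

/-- **discrete second-moment bound**: for integers, `(2t+1) Σ w - m t (t+1) ≤ Σ w²` for every integer `t` -/
lemma sum_sq_ge_discrete {ι : Type*} [Fintype ι] (w : ι → ℤ) (t : ℤ) :
    (2 * t + 1) * ∑ j, w j - (Fintype.card ι : ℤ) * (t * (t + 1)) ≤ ∑ j, (w j) ^ 2 := by
  have key : ∀ j, 0 ≤ (w j - t) * (w j - t - 1) := by
    intro j
    rcases le_or_gt (w j - t) 0 with h | h
    · exact mul_nonneg_of_nonpos_of_nonpos h (by linarith)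
    · exact mul_nonneg (by linarith) (by linarith)
  have hsum : 0 ≤ ∑ j, (w j - t) * (w j - t - 1) := Finset.sum_nonneg fun j _ => key j
  have expand : ∀ j, (w j - t) * (w j - t - 1) = ((w j) ^ 2 - (2 * t + 1) * w j) + t * (t + 1) := fun j => by ring
  simp_rw [expand] at hsum
  rw [Finset.sum_add_distrib, Finset.sum_sub_distrib, ← Finset.mul_sum, Finset.sum_const, Finset.card_univ,
    nsmul_eq_mul] at hsum
  linarith

section moments
variable {P B : Type*} [Fintype P] [DecidableEq P] [Fintype B] [DecidableEq B]

/-- **Orbit-row moments** (the construction of `orbitCount_cs`, exporting the discrete inequalities): with `m` the number of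
`τ`-classes of moved blocks there is an integer `0 ≤ σ ≤ 333` with `(2t+1)(333 - σ) - m t (t+1) ≤ 167 + 166 p - p σ` for EVERY
integer `t`. -/
theorem orbitCount_moments (N : P → B → ℤ) (h01 : ∀ x y, N x y = 0 ∨ N x y = 1)
    (hrow : ∀ x, ∑ y, N x y = 333) (hpair : ∀ x x', x ≠ x' → ∑ y, N x y * N x' y = 166)
    (p : ℕ) (hp : p.Prime)
    (ρ : Equiv.Perm P) (τ : Equiv.Perm B) (hN : ∀ x y, N (ρ x) (τ y) = N x y)
    (hρ : ρ ^ p = 1) (hτ : τ ^ p = 1) (x₀ : P) (hx₀ : ρ x₀ ≠ x₀) :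
    ∃ σ : ℤ, 0 ≤ σ ∧ σ ≤ 333 ∧ ∀ t : ℤ,
      (2 * t + 1) * (333 - σ) - ((blockClasses τ p).card : ℤ) * (t * (t + 1)) ≤ 167 + 166 * (p : ℤ) - (p : ℤ) * σ := by
  have hNi : ∀ i x y, N ((ρ ^ i) x) ((τ ^ i) y) = N x y := aut_pow_apply N ρ τ hN
  set O := orbFin ρ p x₀ with hOdef
  have hOcard : O.card = p := card_orbFin ρ hp hρ hx₀
  have hx₀O : x₀ ∈ O := mem_orbFin_self ρ hp.pos x₀
  set T : Finset (Finset B) := blockClasses τ p with hTdef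
  have hTdef' : T = (univ.filter (fun y => τ y ≠ y)).image (orbFin τ p) := rfl
  let cls : B → Option {C // C ∈ T} := fun y =>
    if h : τ y = y then none else some ⟨orbFin τ p y, Finset.mem_image_of_mem _ (Finset.mem_filter.mpr ⟨mem_univ _, h⟩)⟩
  have fib_none : univ.filter (fun y => cls y = none) = univ.filter (fun y => τ y = y) := by
    ext y; simp only [Finset.mem_filter, Finset.mem_univ, true_and, cls]
    by_cases h : τ y = y <;> simp [h]
  have fib_some : ∀ C : {C // C ∈ T}, univ.filter (fun y => cls y = some C) = C.1 := by
    rintro ⟨C, hC⟩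
    obtain ⟨y₀, hy₀, rfl⟩ := Finset.mem_image.mp hC
    have hy₀' : τ y₀ ≠ y₀ := (Finset.mem_filter.mp hy₀).2
    ext y
    simp only [Finset.mem_filter, Finset.mem_univ, true_and, cls]
    constructor
    · intro h
      by_cases hy : τ y = y
      · simp [hy] at h
      · simp only [hy, ↓reduceDIte, Option.some.injEq, Subtype.mk.injEq] at h
        rw [← h]; exact mem_orbFin_self τ hp.pos y
    · intro h
      have hy : τ y ≠ y := moved_of_mem_orbFin τ hτ hy₀' h
      simp only [hy, ↓reduceDIte, Option.some.injEq, Subtype.mk.injEq]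
      exact orbFin_eq_of_mem τ hp hτ hy₀' h
  have cls_moved : ∀ C : {C // C ∈ T}, ∃ y₀, τ y₀ ≠ y₀ ∧ C.1 = orbFin τ p y₀ := by
    rintro ⟨C, hC⟩
    obtain ⟨y₀, hy₀, rfl⟩ := Finset.mem_image.mp hC
    exact ⟨y₀, (Finset.mem_filter.mp hy₀).2, rfl⟩
  let w : {C // C ∈ T} → ℤ := fun C => ∑ y ∈ C.1, N x₀ y
  have hw : ∀ x ∈ O, ∀ C, ∑ y ∈ univ.filter (fun y => cls y = some C), N x y = w C := by
    intro x hx C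
    rw [fib_some C]
    obtain ⟨y₀, hy₀, hCeq⟩ := cls_moved C
    obtain ⟨i, hi, rfl⟩ := Finset.mem_image.mp hx
    show ∑ y ∈ C.1, N ((ρ ^ i) x₀) y = ∑ y ∈ C.1, N x₀ y
    rw [hCeq, ← image_pow_orbFin τ hp hτ hy₀ i, Finset.sum_image (fun a _ b _ h => (τ ^ i).injective h)]
    rw [image_pow_orbFin τ hp hτ hy₀ i]
    exact Finset.sum_congr rfl fun y _ => hNi i x₀ y
  have hw' : ∀ C y, cls y = some C → ∑ x ∈ O, N x y = w C := by
    intro C y hy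
    have hyC : y ∈ C.1 := by rw [← fib_some C]; exact Finset.mem_filter.mpr ⟨mem_univ _, hy⟩
    obtain ⟨y₀, hy₀, hCeq⟩ := cls_moved C
    have const : ∀ y' (i : ℕ), ∑ x ∈ O, N x ((τ ^ i) y') = ∑ x ∈ O, N x y' := by
      intro y' i
      rw [hOdef, ← image_pow_orbFin ρ hp hρ hx₀ i, Finset.sum_image (fun a _ b _ h => (ρ ^ i).injective h)]
      rw [image_pow_orbFin ρ hp hρ hx₀ i]
      exact Finset.sum_congr rfl fun x _ => hNi i x y'
    have eqcount : ∀ y' ∈ C.1, ∑ x ∈ O, N x y' = ∑ x ∈ O, N x y₀ := by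
      intro y' hy'
      rw [hCeq] at hy'
      obtain ⟨i, hi, rfl⟩ := Finset.mem_image.mp hy'
      exact const y₀ i
    have dc : ∑ y' ∈ C.1, ∑ x ∈ O, N x y' = ∑ x ∈ O, ∑ y' ∈ C.1, N x y' := Finset.sum_comm
    rw [Finset.sum_congr rfl eqcount, Finset.sum_const] at dc
    have hCcard : C.1.card = p := by rw [hCeq]; exact card_orbFin τ hp hτ hy₀
    have inner : ∀ x ∈ O, ∑ y' ∈ C.1, N x y' = w C := by
      intro x hx; rw [← fib_some C]; exact hw x hx C
    rw [Finset.sum_congr rfl inner, Finset.sum_const, hOcard, hCcard] at dc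
    rw [eqcount y hyC]
    have hp0 : (p : ℤ) ≠ 0 := by exact_mod_cast hp.ne_zero
    have : (p : ℤ) * ∑ x ∈ O, N x y₀ = (p : ℤ) * w C := by
      simpa [nsmul_eq_mul] using dc
    exact mul_left_cancel₀ hp0 this
  have hfix : ∀ y, cls y = none → N x₀ y = 1 → ∀ x ∈ O, N x y = 1 := by
    intro y hy h1 x hx
    have hyfix : τ y = y := by
      have : y ∈ univ.filter (fun y => cls y = none) := Finset.mem_filter.mpr ⟨mem_univ _, hy⟩
      rw [fib_none] at this; exact (Finset.mem_filter.mp this).2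
    obtain ⟨i, hi, rfl⟩ := Finset.mem_image.mp hx
    rw [← perm_pow_apply_of_fixed τ hyfix i, hNi]; exact h1
  obtain ⟨h1, h2⟩ := orbitRow_identities N h01 333 166 hrow hpair O p hOcard x₀ hx₀O cls w hw hw' hfix
    (∑ y ∈ univ.filter (fun y => cls y = none), N x₀ y) rfl
  set σ := ∑ y ∈ univ.filter (fun y => cls y = none), N x₀ y with hσdef
  have hmT : Fintype.card {C // C ∈ T} = T.card := Fintype.card_coe T

  -- bounds for σ and the discrete inequalities
  have hw_nonneg : ∀ C, 0 ≤ w C := fun C => Finset.sum_nonneg fun y _ => by rcases h01 x₀ y with h | h <;> simp [h]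
  have hσ0 : 0 ≤ σ := Finset.sum_nonneg fun y _ => by rcases h01 x₀ y with h | h <;> simp [h]
  have hwsum : 0 ≤ ∑ j, w j := Finset.sum_nonneg fun C _ => hw_nonneg C
  refine ⟨σ, hσ0, by linarith, fun t => ?_⟩
  have hd := sum_sq_ge_discrete w t
  rw [hmT, h1] at hd
  have h2' : ∑ j, (w j) ^ 2 = 167 + 166 * (p : ℤ) - (p : ℤ) * σ := by linarith
  rw [h2'] at hd
  exact hd

end moments

section tables

set_option maxRecDepth 400000 in
/-- `p = 3`, `150 ≤ m ≤ 166`: the discrete bound with `t = ⌊(333-σ)/m⌋` beats the second moment for every `σ ≤ 333` -/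
lemma disc3 : ∀ m ∈ Finset.range 167, 150 ≤ m → ∀ σ ∈ Finset.range 334,
    (167 : ℤ) + 166 * 3 - 3 * (σ : ℤ) <
      (2 * (((333 - σ) / m : ℕ) : ℤ) + 1) * (333 - (σ : ℤ)) - (m : ℤ) * ((((333 - σ) / m : ℕ) : ℤ) * ((((333 - σ) / m : ℕ) : ℤ) + 1)) := by
  decide

set_option maxRecDepth 400000 in
/-- `p = 5`, `107 ≤ m ≤ 111` -/
lemma disc5 : ∀ m ∈ Finset.range 112, 107 ≤ m → ∀ σ ∈ Finset.range 334,
    (167 : ℤ) + 166 * 5 - 5 * (σ : ℤ) <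
      (2 * (((333 - σ) / m : ℕ) : ℤ) + 1) * (333 - (σ : ℤ)) - (m : ℤ) * ((((333 - σ) / m : ℕ) : ℤ) * ((((333 - σ) / m : ℕ) : ℤ) + 1)) := by
  decide

set_option maxRecDepth 400000 in
/-- `p = 7`, `82 ≤ m ≤ 83` -/
lemma disc7 : ∀ m ∈ Finset.range 84, 82 ≤ m → ∀ σ ∈ Finset.range 334,
    (167 : ℤ) + 166 * 7 - 7 * (σ : ℤ) <
      (2 * (((333 - σ) / m : ℕ) : ℤ) + 1) * (333 - (σ : ℤ)) - (m : ℤ) * ((((333 - σ) / m : ℕ) : ℤ) * ((((333 - σ) / m : ℕ) : ℤ) + 1)) := by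
  decide

end tables

section final
variable {P B : Type*} [Fintype P] [DecidableEq P] [Fintype B] [DecidableEq B]

/-- the common step: a table for `m₁ ≤ m < m₂` contradicts the moments, so `m < m₁ ∨ m₂ ≤ m` -/
lemma orbitCount_cut (N : P → B → ℤ) (h01 : ∀ x y, N x y = 0 ∨ N x y = 1)
    (hrow : ∀ x, ∑ y, N x y = 333) (hpair : ∀ x x', x ≠ x' → ∑ y, N x y * N x' y = 166)
    {p : ℕ} (hp : p.Prime) (m₁ m₂ : ℕ)
    (htab : ∀ m ∈ Finset.range m₂, m₁ ≤ m → ∀ σ ∈ Finset.range 334,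
      (167 : ℤ) + 166 * (p : ℤ) - (p : ℤ) * (σ : ℤ) <
        (2 * (((333 - σ) / m : ℕ) : ℤ) + 1) * (333 - (σ : ℤ)) -
          (m : ℤ) * ((((333 - σ) / m : ℕ) : ℤ) * ((((333 - σ) / m : ℕ) : ℤ) + 1)))
    (ρ : Equiv.Perm P) (τ : Equiv.Perm B) (hN : ∀ x y, N (ρ x) (τ y) = N x y)
    (hρ : ρ ^ p = 1) (hτ : τ ^ p = 1) (x₀ : P) (hx₀ : ρ x₀ ≠ x₀) :
    (blockClasses τ p).card < m₁ ∨ m₂ ≤ (blockClasses τ p).card := by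
  by_contra hcon
  push Not at hcon
  obtain ⟨σ, hσ0, hσ1, hdisc⟩ := orbitCount_moments N h01 hrow hpair p hp ρ τ hN hρ hτ x₀ hx₀
  obtain ⟨s, rfl⟩ : ∃ s : ℕ, σ = (s : ℤ) := ⟨σ.toNat, (Int.toNat_of_nonneg hσ0).symm⟩
  have hs : s ∈ Finset.range 334 := Finset.mem_range.mpr (by omega)
  have ht := htab (blockClasses τ p).card (Finset.mem_range.mpr hcon.2) hcon.1 s hs
  have hd := hdisc (((333 - s) / (blockClasses τ p).card : ℕ) : ℤ)
  linarith

/-- **`p = 3`: `168 ≤ m ≤ 222`, `m` even** (kernel; = the census statement) -/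
theorem orbitCount_3' (N : P → B → ℤ) (h01 : ∀ x y, N x y = 0 ∨ N x y = 1)
    (hrow : ∀ x, ∑ y, N x y = 333) (hpair : ∀ x x', x ≠ x' → ∑ y, N x y * N x' y = 166)
    (hcol : ∀ y, ∑ x, N x y = 333) (hcpair : ∀ y y', y ≠ y' → ∑ x, N x y * N x y' = 166)
    (hB : Fintype.card B = 667)
    (ρ : Equiv.Perm P) (τ : Equiv.Perm B) (hN : ∀ x y, N (ρ x) (τ y) = N x y)
    (hρ : ρ ^ 3 = 1) (hτ : τ ^ 3 = 1) (x₀ : P) (hx₀ : ρ x₀ ≠ x₀) :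
    168 ≤ (blockClasses τ 3).card ∧ (blockClasses τ 3).card ≤ 222 ∧ 2 ∣ (blockClasses τ 3).card := by
  obtain ⟨hlo, hhi, h2⟩ := orbitCount_3 N h01 hrow hpair hcol hcpair hB ρ τ hN hρ hτ x₀ hx₀
  have hcut := orbitCount_cut N h01 hrow hpair (by norm_num) 150 167 (by exact_mod_cast disc3) ρ τ hN hρ hτ x₀ hx₀
  omega

/-- **`p = 5`: `112 ≤ m ≤ 132`, `m` even** (kernel; = the census statement) -/
theorem orbitCount_5' (N : P → B → ℤ) (h01 : ∀ x y, N x y = 0 ∨ N x y = 1)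
    (hrow : ∀ x, ∑ y, N x y = 333) (hpair : ∀ x x', x ≠ x' → ∑ y, N x y * N x' y = 166)
    (hcol : ∀ y, ∑ x, N x y = 333) (hcpair : ∀ y y', y ≠ y' → ∑ x, N x y * N x y' = 166)
    (hB : Fintype.card B = 667)
    (ρ : Equiv.Perm P) (τ : Equiv.Perm B) (hN : ∀ x y, N (ρ x) (τ y) = N x y)
    (hρ : ρ ^ 5 = 1) (hτ : τ ^ 5 = 1) (x₀ : P) (hx₀ : ρ x₀ ≠ x₀) :
    112 ≤ (blockClasses τ 5).card ∧ (blockClasses τ 5).card ≤ 132 ∧ 2 ∣ (blockClasses τ 5).card := by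
  obtain ⟨hlo, hhi, h2⟩ := orbitCount_5 N h01 hrow hpair hcol hcpair hB ρ τ hN hρ hτ x₀ hx₀
  have hcut := orbitCount_cut N h01 hrow hpair (by norm_num) 107 112 (by exact_mod_cast disc5) ρ τ hN hρ hτ x₀ hx₀
  omega

/-- **`p = 7`: `84 ≤ m ≤ 94`, `m` even** (kernel; = the census statement at the orbit-row level) -/
theorem orbitCount_7' (N : P → B → ℤ) (h01 : ∀ x y, N x y = 0 ∨ N x y = 1)
    (hrow : ∀ x, ∑ y, N x y = 333) (hpair : ∀ x x', x ≠ x' → ∑ y, N x y * N x' y = 166)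
    (hcol : ∀ y, ∑ x, N x y = 333) (hcpair : ∀ y y', y ≠ y' → ∑ x, N x y * N x y' = 166)
    (hB : Fintype.card B = 667)
    (ρ : Equiv.Perm P) (τ : Equiv.Perm B) (hN : ∀ x y, N (ρ x) (τ y) = N x y)
    (hρ : ρ ^ 7 = 1) (hτ : τ ^ 7 = 1) (x₀ : P) (hx₀ : ρ x₀ ≠ x₀) :
    84 ≤ (blockClasses τ 7).card ∧ (blockClasses τ 7).card ≤ 94 ∧ 2 ∣ (blockClasses τ 7).card := by
  obtain ⟨hlo, hhi, h2⟩ := orbitCount_7 N h01 hrow hpair hcol hcpair hB ρ τ hN hρ hτ x₀ hx₀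
  have hcut := orbitCount_cut N h01 hrow hpair (by norm_num) 82 84 (by exact_mod_cast disc7) ρ τ hN hρ hτ x₀ hx₀
  omega

end final

end Summit.Ventures.DiscreteObjects.Hadamard
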